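import Summits.QuantumFields.YangMills.Theorems.UnitScaleTiltProp7LODProjectorGlue
import Literature.MathematicalPhysics.QuantumFieldTheory.Balaban1983to89.B11Eq103H1Complex
import HarnessLib

/-!
# Route `UnitScaleTilt`, crux K1 «MinimiserStabilityRegPr» (stmt-QuantumFields-19200), EX positivity block, LOD ∕ Combes–Thomas line (★★OWNER RULINGS №33–№35),
# brick (L6b) «R-REDUCTION» — **THE R-TERM FLOOR `‖R(Δλ)‖ ≥ ‖Δλ‖ − |Q″λ|∕m_B` AND ITS GRAM INPUT IN `H¹` CURRENCY**

Fleet seat ★`ym-ust-19200-p1` (gen 24, chair of the 19200 positivity knit, lead of the LOD line).  THEOREMS ONLY (0 `def`, 0 `sorry`); `--supports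
stmt-QuantumFields-19200 --as helper`, count-neutral.  Abstract finite-dimensional inner-product-space algebra (Mathlib letters + the tree's `projR` of
`B11Eq103H1Complex`), continuing ✓`Prop7LODProjectorGlue` (p747104).

WHY.  The γ-row `hGF` of the EX display (S44ᴸγ) is the curved analogue of ✓`Prop7FlatCoercivityR.flat_coercive_R_T3`:
`γ‖A‖² ≤ Re⟪A, Δ^η(U₀)A⟫ + ‖R_{Q″}(U₀)D*_{U₀}A‖² + a‖Q_k(U₀)A‖²`, where `R_{Q″} = projR (Δ_{U₀}) Q″` is print's residual-gauge projector (3.21) — the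
orthogonal projection onto `Δ_{U₀}(ker Q″)` — and `P = 1 − R` projects onto `(Δ_{U₀} ker Q″)ᗮ = range (G_a∘Q″†)`, `G_a = (Δ_{U₀} + aQ″†Q″)⁻¹`
(✓`Prop7LODProjectorGlue.orthogonal_map_ker_eq_range_comp`).  On gauge modes `A = D_{U₀}λ` the `R`-term reads `‖R(Δ_{U₀}λ)‖²`, and the whole difficulty of
the residual-gauge term is: how much of `Δλ` does `P` remove?  ANSWER (this file, §2): **`‖P(Δλ)‖ ≤ ‖Q″λ‖∕m_B`**, where `m_B` is the coarse-Gram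
coercivity constant `m_B‖c‖ ≤ ‖G_a(Q″†c)‖` of brick (L4′) — EXACT ALGEBRA, no decay of `P`, no `H²` row: writing `P(Δλ) = G_aQ″†c`,
`‖P(Δλ)‖² = ⟪G_aQ″†c, Δλ⟫ = ⟪c − aQ″(G_aQ″†c), Q″λ⟫` and `‖c − aQ″w‖² ≤ ‖c‖² − a·Re⟪Δw, w⟫·… ≤ ‖c‖²` (`w = G_aQ″†c`, positivity of `Δ`).  Hence the
**R-TERM FLOOR `‖R(Δλ)‖ ≥ ‖Δλ‖ − ‖Q″λ‖∕m_B`**: on gauge parameters with small coarse part the residual Landau term is as strong as the full one.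
§1 supplies `m_B` in the `H¹` currency the line actually has (pen (BUMP) ✓`Prop7CovariantBlockBumps.exists_blockBump_rightInverse_of_regPr`: an EXACT right
inverse `E` of `Q″` with `‖D(Ec)‖ ≤ β‖c‖`; the `H²` row `‖Δ(Ec)‖` of ✓`norm_le_norm_inv_adjoint_of_interpolant` is NOT available, LOCATE-BUMP (W2)):
the ENERGY ARGUMENT `‖c‖² = ⟪Tc, Ec⟫ = 𝔞(G_aTc, Ec) ≤ 𝔞(u,u)^{1∕2}𝔞(Ec,Ec)^{1∕2}`, `𝔞(v,w) = ⟪Dv,Dw⟫ + a⟪Qv,Qw⟫`, `𝔞(u,u) = Re⟪c, Qu⟫ ≤ q‖c‖‖u‖` ⟹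
**`‖c‖ ≤ q(β² + a)·‖G_a(Tc)‖`** (px10 g9's (L4′) formula, typed abstractly).

WHAT IS PROVED (ns `…Theorems.Prop7RTermFloor`; `E`, `F`, `W` complex inner-product spaces, `E` finite-dimensional where projections occur).
§1 `energyForm_cauchySchwarz` (Cauchy–Schwarz for `𝔞(v,w) = ⟪Dv,Dw⟫ + a⟪Qv,Qw⟫`, `0 ≤ a`) · ★★ `norm_le_of_energy_interpolant` ((L4′) in `H¹` currency).
§2 `norm_sub_smul_le_of_positive` (the step `‖c − aQw‖ ≤ ‖c‖`) · ★★★ `norm_proj_orthogonal_map_ker_le` (`‖P(Δλ)‖ ≤ ‖Qλ‖∕m`) ·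
★★★ `norm_sub_le_norm_proj_map_ker` (the R-TERM FLOOR `‖Δλ‖ − ‖Qλ‖∕m ≤ ‖R(Δλ)‖`, `R =` Mathlib's `starProjection` of `(ker Q).map Δ`) ·
★★ `norm_sub_le_norm_projR` (the same in the tree's letter `B11Eq103H1Complex.projR Δ Q` = the fleet's `R_S` on the Lift locus by ✓`RS_eq_projR_iff_lift`).

HONEST SCOPE.  Abstract algebra; at the member `Δ := covLapSite U₀` (symmetric, positive), `Q := Q″` (top nested covariant mean of record), `T := Q″†`,
`G := G_a`, `m := m_B` from §1 with px10's `E`.  This is ONE input of brick (L6b) (R-reduction of the curved R-CORE to local coercivity + a gauge-sector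
floor); nothing of (3.49), Thm 3.1∕3.3∕3.11, `h349`, `hGF`, EX or the crux is proved here.  Rung R3 — NOT d = 4, NOT infinite volume, NOT a mass gap, NOT Clay.

References: T. Bałaban, CMP **99** (1985) 389–434 [Balaban1985BackgroundPropagators] ((3.20)–(3.27) pp.394–395, Thm 3.1 p.397, Thm 3.11 p.416);
CMP **95** (1984) 17–40 [Balaban1984PropagatorsI] ((1.70)–(1.72) pp.29–30, Prop. 1.1 (1.90) p.33).
-/

set_option autoImplicit false

noncomputable section

open scoped InnerProductSpace ComplexConjugate

namespace Summit.QuantumFields.YangMills.Theorems.Prop7RTermFloor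

open Summit.QuantumFields.YangMills.Theorems.Prop7LODProjectorGlue (orthogonal_map_ker_eq_range_comp)
open Literature.MathematicalPhysics.QuantumFieldTheory.Balaban1983to89.B11Eq103H1Complex (projR)

variable {E F W : Type*} [NormedAddCommGroup E] [InnerProductSpace ℂ E] [NormedAddCommGroup F] [InnerProductSpace ℂ F]
  [NormedAddCommGroup W] [InnerProductSpace ℂ W]

/-! ## §0 Real parts (Complex letters) -/

section Re

variable {X : Type*} [NormedAddCommGroup X] [InnerProductSpace ℂ X]

/-- `Re⟪x, x⟫ = ‖x‖²` in `Complex.re` letters (cousin: lit `NumericalRadiusPower.bergerPearcy_re_inner_self`; not imported to keep the cone small). [folklore] -/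
theorem complex_re_inner_self (x : X) : (⟪x, x⟫_ℂ).re = ‖x‖ ^ 2 := by
  rw [← RCLike.re_to_complex]; exact inner_self_eq_norm_sq x

/-- `Re z ≤ ‖z‖` in `Complex.re` letters. [folklore] -/
theorem complex_re_le_norm (z : ℂ) : z.re ≤ ‖z‖ := (le_abs_self _).trans (Complex.abs_re_le_norm z)

end Re

/-! ## §1 (L4′) in `H¹` currency: Gram coercivity from an exact right inverse with bounded gradient -/

section Energy

/-- Cauchy–Schwarz for the energy form `𝔞(v,w) = ⟪Dv,Dw⟫ + a⟪Qv,Qw⟫`, `0 ≤ a`: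
`‖𝔞(v,w)‖² ≤ (‖Dv‖² + a‖Qv‖²)(‖Dw‖² + a‖Qw‖²)`. [folklore] -/
theorem energyForm_cauchySchwarz (D : E →ₗ[ℂ] W) (Q : E →ₗ[ℂ] F) {a : ℝ} (ha : 0 ≤ a) (v w : E) :
    ‖⟪D v, D w⟫_ℂ + (a : ℂ) * ⟪Q v, Q w⟫_ℂ‖ ^ 2 ≤ (‖D v‖ ^ 2 + a * ‖Q v‖ ^ 2) * (‖D w‖ ^ 2 + a * ‖Q w‖ ^ 2) := by
  have h1 : ‖⟪D v, D w⟫_ℂ + (a : ℂ) * ⟪Q v, Q w⟫_ℂ‖ ≤ ‖D v‖ * ‖D w‖ + a * (‖Q v‖ * ‖Q w‖) := by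
    calc ‖⟪D v, D w⟫_ℂ + (a : ℂ) * ⟪Q v, Q w⟫_ℂ‖ ≤ ‖⟪D v, D w⟫_ℂ‖ + ‖(a : ℂ) * ⟪Q v, Q w⟫_ℂ‖ := norm_add_le _ _
      _ ≤ ‖D v‖ * ‖D w‖ + a * (‖Q v‖ * ‖Q w‖) := by
          refine add_le_add (norm_inner_le_norm _ _) ?_
          rw [norm_mul, Complex.norm_real, Real.norm_of_nonneg ha]
          exact mul_le_mul_of_nonneg_left (norm_inner_le_norm _ _) ha
  have h0 : 0 ≤ ‖⟪D v, D w⟫_ℂ + (a : ℂ) * ⟪Q v, Q w⟫_ℂ‖ := norm_nonneg _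
  have h2 : (‖D v‖ * ‖D w‖ + a * (‖Q v‖ * ‖Q w‖)) ^ 2 ≤ (‖D v‖ ^ 2 + a * ‖Q v‖ ^ 2) * (‖D w‖ ^ 2 + a * ‖Q w‖ ^ 2) := by
    nlinarith [sq_nonneg (‖D v‖ * ‖Q w‖ - ‖Q v‖ * ‖D w‖), mul_nonneg ha (sq_nonneg (‖D v‖ * ‖Q w‖ - ‖Q v‖ * ‖D w‖)),
      norm_nonneg (D v), norm_nonneg (D w), norm_nonneg (Q v), norm_nonneg (Q w), sq_nonneg a]
  calc ‖⟪D v, D w⟫_ℂ + (a : ℂ) * ⟪Q v, Q w⟫_ℂ‖ ^ 2 ≤ (‖D v‖ * ‖D w‖ + a * (‖Q v‖ * ‖Q w‖)) ^ 2 := pow_le_pow_left₀ h0 h1 2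
    _ ≤ _ := h2

/-- ★★ **(L4′) IN `H¹` CURRENCY — GRAM COERCIVITY FROM AN EXACT RIGHT INVERSE WITH BOUNDED GRADIENT.**  Let the form of `A` be the energy form
`⟪Av, w⟫ = ⟪Dv, Dw⟫ + a⟪Qv, Qw⟫` (`0 ≤ a`), `G` a right inverse of `A`, `T` an adjoint of `Q`, `‖Qv‖ ≤ q‖v‖`, and `S` an EXACT right inverse of `Q`
(`Q(Sc) = c`) with `‖D(Sc)‖ ≤ β‖c‖`.  Then **`‖c‖ ≤ q·(β² + a)·‖G(Tc)‖`** for every coarse `c` (energy argument: `‖c‖² = ⟪Tc, Sc⟫ = 𝔞(G(Tc), Sc)`,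
Cauchy–Schwarz in `𝔞`, `𝔞(u,u) = Re⟪c, Qu⟫ ≤ q‖c‖‖u‖`, `𝔞(Sc,Sc) ≤ (β² + a)‖c‖²`).  At the member: `A = Δ_{U₀} + aQ″†Q″`, `S = E` of pen (BUMP),
`D = D_{U₀}` on site fields.  OPERATOR-ROAD TWIN of the tree's weak-solution form ✓`Prop7CovariantBlockBumps.norm_le_of_energy_rightInverse` (px10 g9, p748873 §5:
hypothesis `hweak : ∀ v, ⟪Du,Dv⟫ + a⟪Qu,Qv⟫ = ⟪c,Qv⟫`); this door quantifies `A, G, T` so that (L6b) consumers discharge nothing. [cite: Balaban1985BackgroundPropagators, Thm 3.1 p.397] -/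
theorem norm_le_of_energy_interpolant (A G : E →ₗ[ℂ] E) (D : E →ₗ[ℂ] W) (Q : E →ₗ[ℂ] F) (T : F →ₗ[ℂ] E) {a : ℝ} (ha : 0 ≤ a)
    (hA : ∀ v w : E, ⟪A v, w⟫_ℂ = ⟪D v, D w⟫_ℂ + (a : ℂ) * ⟪Q v, Q w⟫_ℂ) (hAG : ∀ v, A (G v) = v)
    (hT : ∀ (l : E) (c : F), ⟪Q l, c⟫_ℂ = ⟪l, T c⟫_ℂ) {q : ℝ} (hq : 0 ≤ q) (hQ : ∀ v, ‖Q v‖ ≤ q * ‖v‖)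
    (S : F →ₗ[ℂ] E) (hQS : ∀ c, Q (S c) = c) {β : ℝ} (hDS : ∀ c, ‖D (S c)‖ ≤ β * ‖c‖) (c : F) :
    ‖c‖ ≤ q * (β ^ 2 + a) * ‖G (T c)‖ := by
  -- `‖c‖² = ⟪T c, S c⟫ = ⟪A (G (T c)), S c⟫ = 𝔞(G (T c), S c)`
  have h1 : ⟪A (G (T c)), S c⟫_ℂ = ⟪c, c⟫_ℂ := by rw [hAG, ← inner_conj_symm, ← hT, hQS, inner_conj_symm]
  have hcc : ‖c‖ ^ 2 = (⟪D (G (T c)), D (S c)⟫_ℂ + (a : ℂ) * ⟪Q (G (T c)), Q (S c)⟫_ℂ).re := by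
    rw [← hA, h1, complex_re_inner_self]
  have hc4 : ‖c‖ ^ 4 ≤ ‖⟪D (G (T c)), D (S c)⟫_ℂ + (a : ℂ) * ⟪Q (G (T c)), Q (S c)⟫_ℂ‖ ^ 2 := by
    have h := complex_re_le_norm (⟪D (G (T c)), D (S c)⟫_ℂ + (a : ℂ) * ⟪Q (G (T c)), Q (S c)⟫_ℂ)
    rw [← hcc] at h
    calc ‖c‖ ^ 4 = (‖c‖ ^ 2) ^ 2 := by ring
      _ ≤ _ := pow_le_pow_left₀ (sq_nonneg _) h 2
  -- `𝔞(u,u) = Re⟪c, Q u⟫ ≤ q‖c‖‖u‖`, `u = G (T c)`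
  have hX : ‖D (G (T c))‖ ^ 2 + a * ‖Q (G (T c))‖ ^ 2 = (⟪c, Q (G (T c))⟫_ℂ).re := by
    rw [← complex_re_inner_self, ← complex_re_inner_self, ← Complex.re_ofReal_mul, ← Complex.add_re, ← hA, hAG, ← inner_conj_symm, ← hT,
      inner_conj_symm]
  have hEu : ‖D (G (T c))‖ ^ 2 + a * ‖Q (G (T c))‖ ^ 2 ≤ ‖c‖ * (q * ‖G (T c)‖) := by
    rw [hX]
    calc (⟪c, Q (G (T c))⟫_ℂ).re ≤ ‖⟪c, Q (G (T c))⟫_ℂ‖ := complex_re_le_norm _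
      _ ≤ ‖c‖ * ‖Q (G (T c))‖ := norm_inner_le_norm _ _
      _ ≤ ‖c‖ * (q * ‖G (T c)‖) := mul_le_mul_of_nonneg_left (hQ _) (norm_nonneg _)
  -- `𝔞(Sc,Sc) ≤ (β² + a)‖c‖²`
  have hES : ‖D (S c)‖ ^ 2 + a * ‖Q (S c)‖ ^ 2 ≤ (β ^ 2 + a) * ‖c‖ ^ 2 := by
    rw [hQS]
    have h0 : 0 ≤ ‖D (S c)‖ := norm_nonneg _
    have h1 : ‖D (S c)‖ ^ 2 ≤ (β * ‖c‖) ^ 2 := pow_le_pow_left₀ h0 (hDS c) 2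
    nlinarith
  have hX0 : 0 ≤ ‖D (G (T c))‖ ^ 2 + a * ‖Q (G (T c))‖ ^ 2 := by positivity
  have hY0 : 0 ≤ ‖D (S c)‖ ^ 2 + a * ‖Q (S c)‖ ^ 2 := by positivity
  have h4 : ‖c‖ ^ 4 ≤ (‖c‖ * (q * ‖G (T c)‖)) * ((β ^ 2 + a) * ‖c‖ ^ 2) :=
    (hc4.trans (energyForm_cauchySchwarz D Q ha _ _)).trans (mul_le_mul hEu hES hY0 (hX0.trans hEu))
  have hK : 0 ≤ q * (β ^ 2 + a) * ‖G (T c)‖ := by positivity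
  by_cases hc : ‖c‖ = 0
  · rw [hc]; exact hK
  · have hcpos : 0 < ‖c‖ := lt_of_le_of_ne (norm_nonneg _) (Ne.symm hc)
    have h5 : ‖c‖ ^ 3 * ‖c‖ ≤ ‖c‖ ^ 3 * (q * (β ^ 2 + a) * ‖G (T c)‖) := by nlinarith
    exact le_of_mul_le_mul_left h5 (by positivity)

end Energy

/-! ## §2 The R-term floor -/

section Floor

/-- The absorption step: if `Δ` is positive (`0 ≤ Re⟪Δv, v⟫`), `T` is an adjoint of `Q`, `0 ≤ a` and `(Δ + a·TQ) w = T c`, then **`‖c − a·Qw‖ ≤ ‖c‖`**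
(`Re⟪c, Qw⟫ = Re⟪Tc, w⟫ = Re⟪Δw, w⟫ + a‖Qw‖² ≥ a‖Qw‖²`, so `‖c − aQw‖² = ‖c‖² − 2a·Re⟪c,Qw⟫ + a²‖Qw‖² ≤ ‖c‖² − a²‖Qw‖²`).
[cite: Balaban1985BackgroundPropagators, (3.24)–(3.26) p.395] -/
theorem norm_sub_smul_le_of_positive (Δ : E →ₗ[ℂ] E) (Q : E →ₗ[ℂ] F) (T : F →ₗ[ℂ] E) (hΔpos : ∀ v : E, 0 ≤ (⟪Δ v, v⟫_ℂ).re)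
    (hT : ∀ (l : E) (c : F), ⟪Q l, c⟫_ℂ = ⟪l, T c⟫_ℂ) {a : ℝ} (ha : 0 ≤ a) {w : E} {c : F}
    (h : (Δ + (a : ℂ) • (T ∘ₗ Q)) w = T c) : ‖c - (a : ℂ) • Q w‖ ≤ ‖c‖ := by
  -- `Re⟪c, Qw⟫ = Re⟪Δ w, w⟫ + a‖Qw‖²`
  have hcQ : (⟪c, Q w⟫_ℂ).re = (⟪Δ w, w⟫_ℂ).re + a * ‖Q w‖ ^ 2 := by
    have h1 : ⟪c, Q w⟫_ℂ = ⟪T c, w⟫_ℂ := by rw [← inner_conj_symm, hT, inner_conj_symm]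
    have h2 : ⟪T c, w⟫_ℂ = ⟪Δ w, w⟫_ℂ + (a : ℂ) * ⟪Q w, Q w⟫_ℂ := by
      rw [← h, LinearMap.add_apply, LinearMap.smul_apply, LinearMap.comp_apply, inner_add_left, inner_smul_left,
        Complex.conj_ofReal, ← inner_conj_symm (T (Q w)), ← hT, inner_conj_symm]
    rw [h1, h2, Complex.add_re, Complex.re_ofReal_mul, complex_re_inner_self]
  have hsq : ‖c - (a : ℂ) • Q w‖ ^ 2 = ‖c‖ ^ 2 - 2 * (a * (⟪c, Q w⟫_ℂ).re) + a ^ 2 * ‖Q w‖ ^ 2 := by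
    rw [@norm_sub_sq ℂ, inner_smul_right, RCLike.re_to_complex, Complex.re_ofReal_mul, norm_smul, Complex.norm_real,
      Real.norm_of_nonneg ha]
    ring
  have hle : ‖c - (a : ℂ) • Q w‖ ^ 2 ≤ ‖c‖ ^ 2 := by
    rw [hsq, hcQ]
    nlinarith [hΔpos w, sq_nonneg (a * ‖Q w‖), mul_nonneg ha (hΔpos w)]
  exact (pow_le_pow_iff_left₀ (norm_nonneg _) (norm_nonneg _) two_ne_zero).1 hle

/-- ★★★ **`‖P(Δλ)‖ ≤ ‖Qλ‖∕m` — HOW MUCH OF `Δλ` THE PROJECTOR `P = 1 − R` REMOVES.**  `Δ` symmetric and positive, `T` an adjoint of `Q`, `0 ≤ a`, `G` the two-sided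
inverse of `Δ + a·TQ` with the coarse-Gram coercivity `m‖c‖ ≤ ‖G(Tc)‖` (`0 < m`, brick (L4′) — §1); `P` = the orthogonal projection onto
`(Δ·ker Q)ᗮ = range (G∘T)` (✓`orthogonal_map_ker_eq_range_comp`).  Then for every `λ`: `‖P(Δλ)‖ ≤ ‖Qλ‖∕m` — writing `P(Δλ) = G(Tc)`:
`‖P(Δλ)‖² = Re⟪G(Tc), Δλ⟫ = Re⟪c − aQ(G(Tc)), Qλ⟫ ≤ ‖c‖·‖Qλ‖ ≤ (‖P(Δλ)‖∕m)·‖Qλ‖`.  EXACT ALGEBRA: no decay of `P`, no `H²` row.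
[cite: Balaban1985BackgroundPropagators, (3.21)–(3.27) pp.394–395] -/
theorem norm_proj_orthogonal_map_ker_le [FiniteDimensional ℂ E] (Δ G : E →ₗ[ℂ] E) (Q : E →ₗ[ℂ] F) (T : F →ₗ[ℂ] E)
    (hΔ : ∀ x y : E, ⟪Δ x, y⟫_ℂ = ⟪x, Δ y⟫_ℂ) (hΔpos : ∀ v : E, 0 ≤ (⟪Δ v, v⟫_ℂ).re)
    (hT : ∀ (l : E) (c : F), ⟪Q l, c⟫_ℂ = ⟪l, T c⟫_ℂ) {a : ℝ} (ha : 0 ≤ a)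
    (hAG : ∀ v, (Δ + (a : ℂ) • (T ∘ₗ Q)) (G v) = v) (hGA : ∀ v, G ((Δ + (a : ℂ) • (T ∘ₗ Q)) v) = v)
    {m : ℝ} (hm : 0 < m) (hcoer : ∀ c : F, m * ‖c‖ ≤ ‖G (T c)‖)
    [((LinearMap.ker Q).map Δ).HasOrthogonalProjection] (l : E) :
    ‖((LinearMap.ker Q).map Δ)ᗮ.starProjection (Δ l)‖ ≤ ‖Q l‖ / m := by
  set K := (LinearMap.ker Q).map Δ with hK
  set w : E := Kᗮ.starProjection (Δ l) with hw
  -- `w ∈ Kᗮ = range (G ∘ T)`: `w = G (T c)`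
  have hwmem : w ∈ Kᗮ := Kᗮ.starProjection_apply_mem (Δ l)
  rw [hK, orthogonal_map_ker_eq_range_comp Q T Δ G hΔ hT (a : ℂ) hAG hGA, LinearMap.mem_range] at hwmem
  obtain ⟨c, hc⟩ := hwmem
  rw [LinearMap.comp_apply] at hc
  -- `‖w‖² = Re⟪w, Δ l⟫`
  have hww : ‖w‖ ^ 2 = (⟪w, Δ l⟫_ℂ).re := by
    have h0 : ⟪Δ l - w, w⟫_ℂ = 0 := Kᗮ.starProjection_inner_eq_zero (Δ l) w (Kᗮ.starProjection_apply_mem (Δ l))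
    rw [inner_sub_left, sub_eq_zero] at h0
    rw [← complex_re_inner_self, ← h0, ← inner_conj_symm, Complex.conj_re]
  -- `⟪w, Δ l⟫ = ⟪Δ w, l⟫ = ⟪T(c − aQw), l⟫ = ⟪c − aQw, Q l⟫`
  have hΔw : Δ w = T (c - (a : ℂ) • Q w) := by
    have h := hAG (T c)
    rw [hc, LinearMap.add_apply, LinearMap.smul_apply, LinearMap.comp_apply] at h
    rw [map_sub, map_smul, ← h, add_sub_cancel_right]
  have hwl : ⟪w, Δ l⟫_ℂ = ⟪c - (a : ℂ) • Q w, Q l⟫_ℂ := by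
    rw [← hΔ, hΔw, ← inner_conj_symm, ← hT, inner_conj_symm]
  -- `‖c − aQw‖ ≤ ‖c‖ ≤ ‖w‖ / m`
  have hc_le : ‖c - (a : ℂ) • Q w‖ ≤ ‖c‖ :=
    norm_sub_smul_le_of_positive Δ Q T hΔpos hT ha (by rw [← hc]; exact hAG (T c))
  have hcw : m * ‖c‖ ≤ ‖w‖ := by rw [← hc]; exact hcoer c
  have hw2 : ‖w‖ ^ 2 ≤ ‖w‖ / m * ‖Q l‖ := by
    rw [hww, hwl]
    calc (⟪c - (a : ℂ) • Q w, Q l⟫_ℂ).re ≤ ‖⟪c - (a : ℂ) • Q w, Q l⟫_ℂ‖ := complex_re_le_norm _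
      _ ≤ ‖c - (a : ℂ) • Q w‖ * ‖Q l‖ := norm_inner_le_norm _ _
      _ ≤ ‖c‖ * ‖Q l‖ := mul_le_mul_of_nonneg_right hc_le (norm_nonneg _)
      _ ≤ ‖w‖ / m * ‖Q l‖ := by
          refine mul_le_mul_of_nonneg_right ?_ (norm_nonneg _)
          rw [le_div_iff₀ hm]; linarith
  by_cases h0 : ‖w‖ = 0
  · rw [h0]; positivity
  · have hpos : 0 < ‖w‖ := lt_of_le_of_ne (norm_nonneg _) (Ne.symm h0)
    have h3 : ‖w‖ * ‖w‖ ≤ ‖w‖ * (‖Q l‖ / m) := by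
      calc ‖w‖ * ‖w‖ = ‖w‖ ^ 2 := (sq _).symm
        _ ≤ ‖w‖ / m * ‖Q l‖ := hw2
        _ = ‖w‖ * (‖Q l‖ / m) := by ring
    exact le_of_mul_le_mul_left h3 hpos

/-- ★★★ **THE R-TERM FLOOR `‖Δλ‖ − ‖Qλ‖∕m ≤ ‖R(Δλ)‖`**, `R` = the orthogonal projection onto `Δ·ker Q` (print's (3.21), Mathlib's `starProjection`):
`Δλ = R(Δλ) + P(Δλ)` and `‖P(Δλ)‖ ≤ ‖Qλ‖∕m`.  On gauge parameters with small coarse part `Q″λ` the RESIDUAL Landau term `‖R_{Q″}D*D λ‖` is as strong as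
the full one. [cite: Balaban1985BackgroundPropagators, (3.21) p.394, Thm 3.11 p.416] -/
theorem norm_sub_le_norm_proj_map_ker [FiniteDimensional ℂ E] (Δ G : E →ₗ[ℂ] E) (Q : E →ₗ[ℂ] F) (T : F →ₗ[ℂ] E)
    (hΔ : ∀ x y : E, ⟪Δ x, y⟫_ℂ = ⟪x, Δ y⟫_ℂ) (hΔpos : ∀ v : E, 0 ≤ (⟪Δ v, v⟫_ℂ).re)
    (hT : ∀ (l : E) (c : F), ⟪Q l, c⟫_ℂ = ⟪l, T c⟫_ℂ) {a : ℝ} (ha : 0 ≤ a)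
    (hAG : ∀ v, (Δ + (a : ℂ) • (T ∘ₗ Q)) (G v) = v) (hGA : ∀ v, G ((Δ + (a : ℂ) • (T ∘ₗ Q)) v) = v)
    {m : ℝ} (hm : 0 < m) (hcoer : ∀ c : F, m * ‖c‖ ≤ ‖G (T c)‖)
    [((LinearMap.ker Q).map Δ).HasOrthogonalProjection] (l : E) :
    ‖Δ l‖ - ‖Q l‖ / m ≤ ‖((LinearMap.ker Q).map Δ).starProjection (Δ l)‖ := by
  have hP := norm_proj_orthogonal_map_ker_le Δ G Q T hΔ hΔpos hT ha hAG hGA hm hcoer l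
  have hsum := ((LinearMap.ker Q).map Δ).starProjection_add_starProjection_orthogonal (Δ l)
  have htri : ‖Δ l‖ ≤ ‖((LinearMap.ker Q).map Δ).starProjection (Δ l)‖ + ‖((LinearMap.ker Q).map Δ)ᗮ.starProjection (Δ l)‖ := by
    conv_lhs => rw [← hsum]
    exact norm_add_le _ _
  linarith

/-- ★★ **THE R-TERM FLOOR IN THE TREE'S LETTER `projR`** (`B11Eq103H1Complex.projR Δ Q` = the orthogonal projection onto `Δ·ker Q` = the fleet's `R_S(U₀)` on the
Lift locus by ✓`Prop7LiftOfRSEqPrintProjector.RS_eq_projR_iff_lift`, with `Δ := covLapSite U₀`, `Q := Q″`): **`‖Δλ‖ − ‖Qλ‖∕m ≤ ‖projR Δ Q (Δλ)‖`.**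
[cite: Balaban1985BackgroundPropagators, (3.21) p.394, Thm 3.11 p.416] -/
theorem norm_sub_le_norm_projR [FiniteDimensional ℂ E] (Δ G : E →ₗ[ℂ] E) (Q : E →ₗ[ℂ] F) (T : F →ₗ[ℂ] E)
    (hΔ : ∀ x y : E, ⟪Δ x, y⟫_ℂ = ⟪x, Δ y⟫_ℂ) (hΔpos : ∀ v : E, 0 ≤ (⟪Δ v, v⟫_ℂ).re)
    (hT : ∀ (l : E) (c : F), ⟪Q l, c⟫_ℂ = ⟪l, T c⟫_ℂ) {a : ℝ} (ha : 0 ≤ a)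
    (hAG : ∀ v, (Δ + (a : ℂ) • (T ∘ₗ Q)) (G v) = v) (hGA : ∀ v, G ((Δ + (a : ℂ) • (T ∘ₗ Q)) v) = v)
    {m : ℝ} (hm : 0 < m) (hcoer : ∀ c : F, m * ‖c‖ ≤ ‖G (T c)‖) (l : E) :
    ‖Δ l‖ - ‖Q l‖ / m ≤ ‖projR Δ Q (Δ l)‖ := by
  haveI : CompleteSpace ((LinearMap.ker Q).map Δ) := FiniteDimensional.complete ℂ _
  exact norm_sub_le_norm_proj_map_ker Δ G Q T hΔ hΔpos hT ha hAG hGA hm hcoer l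

end Floor

/-! ## §3 The smoothing bound of `P` on divergences (Step I.4 of LOCATE-L6: H¹ absorption of the `D*` errors) -/

section Smoothing

/-- ★★ **`‖P(D†A)‖ ≤ ‖A‖∕(m·√a)` — THE PROJECTOR `P = 1 − R` SMOOTHS DIVERGENCES.**  `Δ` with the form `⟪Δv, w⟫ = ⟪Dv, Dw⟫`, `D†` an adjoint of `D`
(`⟪Dv, A⟫ = ⟪v, D†A⟫`), `T` an adjoint of `Q`, `0 < a`, `G` the two-sided inverse of `Δ + a·TQ` with coarse-Gram coercivity `m‖c‖ ≤ ‖G(Tc)‖`; `P` the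
orthogonal projection onto `(Δ·ker Q)ᗮ = range(G∘T)`.  Then for every vector field `A`: **`‖P(D†A)‖ ≤ ‖A‖∕(m√a)`** — a DERIVATIVE-FREE bound (`range P`
consists of massive potentials): `P(D†A) = G(Tc)`, `‖P(D†A)‖² = Re⟪G(Tc), D†A⟫ = Re⟪D(G(Tc)), A⟫ ≤ ‖D(G(Tc))‖‖A‖`, and the energy identity
`‖D(GTc)‖² + a‖Q(GTc)‖² = Re⟪c, Q(GTc)⟫ ≤ ‖c‖·‖Q(GTc)‖` gives `‖D(G(Tc))‖ ≤ ‖c‖∕√a ≤ ‖G(Tc)‖∕(m√a)`.  USE ((L6) assembly, Step I.4): `‖D*_UA‖² = ‖R D*_UA‖² +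
‖P D*_UA‖² ≤ ‖R D*_UA‖² + ‖A‖²∕(a m_B²)`, so local-comparison errors `θ·‖D*_UA‖²` are absorbed by the target's own `R`-term plus `θ∕(a m_B²)·‖A‖²`.
[cite: Balaban1985BackgroundPropagators, (3.21)–(3.27) pp.394–395, Thm 3.11 p.416] -/
theorem norm_proj_adjoint_le [FiniteDimensional ℂ E] (Δ G : E →ₗ[ℂ] E) (D : E →ₗ[ℂ] W) (Dad : W →ₗ[ℂ] E) (Q : E →ₗ[ℂ] F) (T : F →ₗ[ℂ] E)
    (hΔ : ∀ x y : E, ⟪Δ x, y⟫_ℂ = ⟪x, Δ y⟫_ℂ) (hΔD : ∀ v w : E, ⟪Δ v, w⟫_ℂ = ⟪D v, D w⟫_ℂ) (hDad : ∀ (v : E) (A : W), ⟪D v, A⟫_ℂ = ⟪v, Dad A⟫_ℂ)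
    (hT : ∀ (l : E) (c : F), ⟪Q l, c⟫_ℂ = ⟪l, T c⟫_ℂ) {a : ℝ} (ha : 0 < a)
    (hAG : ∀ v, (Δ + (a : ℂ) • (T ∘ₗ Q)) (G v) = v) (hGA : ∀ v, G ((Δ + (a : ℂ) • (T ∘ₗ Q)) v) = v)
    {m : ℝ} (hm : 0 < m) (hcoer : ∀ c : F, m * ‖c‖ ≤ ‖G (T c)‖)
    [((LinearMap.ker Q).map Δ).HasOrthogonalProjection] (A : W) :
    ‖((LinearMap.ker Q).map Δ)ᗮ.starProjection (Dad A)‖ ≤ ‖A‖ / (m * Real.sqrt a) := by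
  set K := (LinearMap.ker Q).map Δ with hK
  set w : E := Kᗮ.starProjection (Dad A) with hw
  -- `w ∈ Kᗮ = range (G ∘ T)`: `w = G (T c)`
  have hwmem : w ∈ Kᗮ := Kᗮ.starProjection_apply_mem (Dad A)
  rw [hK, orthogonal_map_ker_eq_range_comp Q T Δ G hΔ hT (a : ℂ) hAG hGA, LinearMap.mem_range] at hwmem
  obtain ⟨c, hc⟩ := hwmem
  rw [LinearMap.comp_apply] at hc
  -- `‖w‖² = Re⟪w, D†A⟫ = Re⟪D w, A⟫ ≤ ‖D w‖‖A‖`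
  have hww : ‖w‖ ^ 2 = (⟪D w, A⟫_ℂ).re := by
    have h0 : ⟪Dad A - w, w⟫_ℂ = 0 := Kᗮ.starProjection_inner_eq_zero (Dad A) w (Kᗮ.starProjection_apply_mem (Dad A))
    rw [inner_sub_left, sub_eq_zero] at h0
    rw [← complex_re_inner_self, ← h0, ← inner_conj_symm, Complex.conj_re, ← hDad]
  -- the energy identity at `w = G (T c)`: `‖D w‖² + a‖Q w‖² = Re⟪c, Q w⟫`
  have hE : ‖D w‖ ^ 2 + a * ‖Q w‖ ^ 2 = (⟪c, Q w⟫_ℂ).re := by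
    have h := hAG (T c)
    rw [hc] at h
    -- `⟪(Δ + aTQ) w, w⟫ = ⟪T c, w⟫ = conj ⟪Q w, c⟫`
    have h1 : ⟪(Δ + (a : ℂ) • (T ∘ₗ Q)) w, w⟫_ℂ = ⟪c, Q w⟫_ℂ := by
      rw [h, ← inner_conj_symm, ← hT, inner_conj_symm]
    rw [LinearMap.add_apply, LinearMap.smul_apply, LinearMap.comp_apply, inner_add_left, inner_smul_left, Complex.conj_ofReal,
      hΔD, ← inner_conj_symm (T (Q w)), ← hT, inner_conj_symm] at h1
    rw [← h1, Complex.add_re, Complex.re_ofReal_mul, complex_re_inner_self, complex_re_inner_self]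
  -- `Re⟪c, Q w⟫ ≤ ‖c‖‖Q w‖` and `a‖Q w‖² ≤ Re⟪c, Q w⟫` ⟹ `‖D w‖² ≤ ‖c‖²∕a`
  have hcQ : (⟪c, Q w⟫_ℂ).re ≤ ‖c‖ * ‖Q w‖ := (complex_re_le_norm _).trans (norm_inner_le_norm _ _)
  have hQw : a * ‖Q w‖ ^ 2 ≤ ‖c‖ * ‖Q w‖ := by nlinarith [sq_nonneg ‖D w‖]
  have hQw' : a * ‖Q w‖ ≤ ‖c‖ := by
    by_cases hq : ‖Q w‖ = 0
    · rw [hq, mul_zero]; exact norm_nonneg _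
    · have hqpos : 0 < ‖Q w‖ := lt_of_le_of_ne (norm_nonneg _) (Ne.symm hq)
      have : ‖Q w‖ * (a * ‖Q w‖) ≤ ‖Q w‖ * ‖c‖ := by nlinarith
      exact le_of_mul_le_mul_left this hqpos
  have hDw : a * ‖D w‖ ^ 2 ≤ ‖c‖ ^ 2 := by
    have h1 : ‖D w‖ ^ 2 ≤ ‖c‖ * ‖Q w‖ := by nlinarith [sq_nonneg ‖Q w‖, ha.le]
    nlinarith [norm_nonneg c, norm_nonneg (Q w)]
  -- `‖c‖ ≤ ‖w‖ / m`
  have hcw : m * ‖c‖ ≤ ‖w‖ := by rw [← hc]; exact hcoer c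
  have hsa : 0 < Real.sqrt a := Real.sqrt_pos.2 ha
  have hDw' : Real.sqrt a * ‖D w‖ ≤ ‖c‖ := by
    have h0 : 0 ≤ Real.sqrt a * ‖D w‖ := by positivity
    have h2 : (Real.sqrt a * ‖D w‖) ^ 2 ≤ ‖c‖ ^ 2 := by rw [mul_pow, Real.sq_sqrt ha.le]; exact hDw
    exact (pow_le_pow_iff_left₀ h0 (norm_nonneg _) two_ne_zero).1 h2
  -- assemble: `‖w‖² ≤ ‖D w‖‖A‖ ≤ (‖w‖/(m√a))‖A‖`
  have hw2 : ‖w‖ ^ 2 ≤ ‖w‖ / (m * Real.sqrt a) * ‖A‖ := by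
    rw [hww]
    calc (⟪D w, A⟫_ℂ).re ≤ ‖⟪D w, A⟫_ℂ‖ := complex_re_le_norm _
      _ ≤ ‖D w‖ * ‖A‖ := norm_inner_le_norm _ _
      _ ≤ ‖w‖ / (m * Real.sqrt a) * ‖A‖ := by
          refine mul_le_mul_of_nonneg_right ?_ (norm_nonneg _)
          rw [le_div_iff₀ (by positivity)]
          calc ‖D w‖ * (m * Real.sqrt a) = m * (Real.sqrt a * ‖D w‖) := by ring
            _ ≤ m * ‖c‖ := mul_le_mul_of_nonneg_left hDw' hm.le
            _ ≤ ‖w‖ := hcw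
  by_cases h0 : ‖w‖ = 0
  · rw [h0]; positivity
  · have hpos : 0 < ‖w‖ := lt_of_le_of_ne (norm_nonneg _) (Ne.symm h0)
    have h3 : ‖w‖ * ‖w‖ ≤ ‖w‖ * (‖A‖ / (m * Real.sqrt a)) := by
      calc ‖w‖ * ‖w‖ = ‖w‖ ^ 2 := (sq _).symm
        _ ≤ ‖w‖ / (m * Real.sqrt a) * ‖A‖ := hw2
        _ = ‖w‖ * (‖A‖ / (m * Real.sqrt a)) := by ring
    exact le_of_mul_le_mul_left h3 hpos

/-- ★★ **H¹ ABSORPTION OF THE DIVERGENCE: `‖D†A‖² ≤ ‖R(D†A)‖² + ‖A‖²∕(m²a)`** (`R` = Mathlib's `starProjection` of `Δ·ker Q`; Pythagoras + the smoothing bound).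
[cite: Balaban1985BackgroundPropagators, (3.21) p.394, Thm 3.11 p.416] -/
theorem normSq_adjoint_le_normSq_proj_add [FiniteDimensional ℂ E] (Δ G : E →ₗ[ℂ] E) (D : E →ₗ[ℂ] W) (Dad : W →ₗ[ℂ] E) (Q : E →ₗ[ℂ] F) (T : F →ₗ[ℂ] E)
    (hΔ : ∀ x y : E, ⟪Δ x, y⟫_ℂ = ⟪x, Δ y⟫_ℂ) (hΔD : ∀ v w : E, ⟪Δ v, w⟫_ℂ = ⟪D v, D w⟫_ℂ) (hDad : ∀ (v : E) (A : W), ⟪D v, A⟫_ℂ = ⟪v, Dad A⟫_ℂ)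
    (hT : ∀ (l : E) (c : F), ⟪Q l, c⟫_ℂ = ⟪l, T c⟫_ℂ) {a : ℝ} (ha : 0 < a)
    (hAG : ∀ v, (Δ + (a : ℂ) • (T ∘ₗ Q)) (G v) = v) (hGA : ∀ v, G ((Δ + (a : ℂ) • (T ∘ₗ Q)) v) = v)
    {m : ℝ} (hm : 0 < m) (hcoer : ∀ c : F, m * ‖c‖ ≤ ‖G (T c)‖)
    [((LinearMap.ker Q).map Δ).HasOrthogonalProjection] (A : W) :
    ‖Dad A‖ ^ 2 ≤ ‖((LinearMap.ker Q).map Δ).starProjection (Dad A)‖ ^ 2 + ‖A‖ ^ 2 / (m ^ 2 * a) := by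
  have hP := norm_proj_adjoint_le Δ G D Dad Q T hΔ hΔD hDad hT ha hAG hGA hm hcoer A
  have hpy := ((LinearMap.ker Q).map Δ).norm_sq_eq_add_norm_sq_starProjection (Dad A)
  have h0 : 0 ≤ ‖((LinearMap.ker Q).map Δ)ᗮ.starProjection (Dad A)‖ := norm_nonneg _
  have h1 : ‖((LinearMap.ker Q).map Δ)ᗮ.starProjection (Dad A)‖ ^ 2 ≤ (‖A‖ / (m * Real.sqrt a)) ^ 2 := pow_le_pow_left₀ h0 hP 2
  have h2 : (‖A‖ / (m * Real.sqrt a)) ^ 2 = ‖A‖ ^ 2 / (m ^ 2 * a) := by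
    rw [div_pow, mul_pow, Real.sq_sqrt ha.le]
  linarith [h2 ▸ h1]

/-- ★ The same in the tree's letter `projR`: **`‖D†A‖² ≤ ‖projR Δ Q (D†A)‖² + ‖A‖²∕(m²a)`** — at the member `Δ := covLapSite U₀`, `D := DL2 U₀`, `D† := DstarL2 U₀`,
`Q := Q″`: the full Landau term is controlled by the RESIDUAL one plus a derivative-free multiple of `‖A‖²`, K- and volume-uniformly.
[cite: Balaban1985BackgroundPropagators, (3.21) p.394, Thm 3.11 p.416] -/
theorem normSq_adjoint_le_normSq_projR_add [FiniteDimensional ℂ E] (Δ G : E →ₗ[ℂ] E) (D : E →ₗ[ℂ] W) (Dad : W →ₗ[ℂ] E) (Q : E →ₗ[ℂ] F) (T : F →ₗ[ℂ] E)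
    (hΔ : ∀ x y : E, ⟪Δ x, y⟫_ℂ = ⟪x, Δ y⟫_ℂ) (hΔD : ∀ v w : E, ⟪Δ v, w⟫_ℂ = ⟪D v, D w⟫_ℂ) (hDad : ∀ (v : E) (A : W), ⟪D v, A⟫_ℂ = ⟪v, Dad A⟫_ℂ)
    (hT : ∀ (l : E) (c : F), ⟪Q l, c⟫_ℂ = ⟪l, T c⟫_ℂ) {a : ℝ} (ha : 0 < a)
    (hAG : ∀ v, (Δ + (a : ℂ) • (T ∘ₗ Q)) (G v) = v) (hGA : ∀ v, G ((Δ + (a : ℂ) • (T ∘ₗ Q)) v) = v)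
    {m : ℝ} (hm : 0 < m) (hcoer : ∀ c : F, m * ‖c‖ ≤ ‖G (T c)‖) (A : W) :
    ‖Dad A‖ ^ 2 ≤ ‖projR Δ Q (Dad A)‖ ^ 2 + ‖A‖ ^ 2 / (m ^ 2 * a) := by
  haveI : CompleteSpace ((LinearMap.ker Q).map Δ) := FiniteDimensional.complete ℂ _
  exact normSq_adjoint_le_normSq_proj_add Δ G D Dad Q T hΔ hΔD hDad hT ha hAG hGA hm hcoer A

end Smoothing

end Summit.QuantumFields.YangMills.Theorems.Prop7RTermFloor

end
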